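import Summits.AtomisticToContinuum.FouriersLaw.Theorems.ParityLiouvilleSeedLiouvilleForHeatHarmonicBoxCoupling
import Summits.AtomisticToContinuum.FouriersLaw.Theorems.ParityLiouvilleSeedLiouvilleForHeatHarmonicBoxGibbs
import Summits.AtomisticToContinuum.FouriersLaw.Theorems.ParityLiouvilleSeedLiouvilleForHeatHarmonicCurrent
import Mathlib.Analysis.Convex.Integral
import Mathlib.Analysis.Convex.SpecificFunctions.Basic

/-!
# The entropy step: finite-volume Gibbs expectations dominate the radiating box marginal

Helper file for the REGULARITY part of the harmonic tightness witness of
`ParityLiouvilleSeed.LiouvilleForHeat` (`stmt-AtomisticToContinuum-13980`).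

For the harmonic chain `P = pinnedChain ω₂ 0 0 γ` (`ω₂ > 0`), `T = 1`, a box `Λ = {a, …, a+n}`, a
boundary condition `η` and a measurable bounded test function `ψ` on box data, the un-normalised
finite-volume Gibbs integral `N_Λ(η) = ∫ e^{ψ(x)} e^{-H_Λ(x|η)} dx` satisfies

  `N_Λ(η) ≥ exp( ∫ ψ dν_Λ - A (n+1) - q_{a-1}(η)² - q_{a+n+1}(η)² )`

(`boxN_ge`), where `ν_Λ` is the box marginal of the radiating state and `A = A(ω₂)`. Proof: write
the Lebesgue integral over box data as a shear integral over the Gaussian coupling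
(`lintegral_cplField_mul`), pass to the coupling law (its density is explicit), and apply Jensen's
inequality to `exp` under the coupling law, whose image under the coupling field map is `ν_Λ`
(`cplMeasure_map_cplField`); the exponent is linear in the box energy, which is dominated by a
diagonal quadratic with `ν`-mean `O(n+1)` (`integral_boxQuad_cplField`).
-/

noncomputable section

open MeasureTheory ProbabilityTheory Filter Set Function
open scoped NNReal ENNReal
open Literature.MathematicalPhysics.KineticTheory.HeatConduction Literature.Probability.LatticeModels

namespace Summit.AtomisticToContinuum.FouriersLaw.Theorems.ParityLiouvilleSeed.HarmonicWitness

variable (ω₂ : ℝ) (a : ℤ) (n : ℕ)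

/-! ### The coupling law pushed to box data is the box marginal -/

/-- **`cplField_* cplMeasure = ν_Λ`**: the coupling realises the box marginal of the radiating state.
[folklore] -/
theorem cplMeasure_map_cplField :
    (cplMeasure ω₂ n).map (cplField a n) = boxMarginal a n (harmonicState ω₂) := by
  rw [← noiseMeasure_map_cplRestrict ω₂ a n, Measure.map_map (measurable_cplField a n) (measurable_cplRestrict a n),
    boxMarginal, harmonicState, Measure.map_map (boxRestrictAt_measurable a n) measurable_gaussField]
  congr 1
  funext ζ
  exact cplField_cplRestrict a n ζ

/-- Integration of box observables against the coupling law is integration against the noise.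
[folklore] -/
theorem integral_comp_cplField {F : (Fin (n + 1) → ℝ × ℝ) → ℝ} (hF : Measurable F) :
    ∫ w, F (cplField a n w) ∂cplMeasure ω₂ n = ∫ ζ, F (boxRestrictAt a n (gaussField ζ)) ∂noiseMeasure ω₂ := by
  have hm : AEStronglyMeasurable (fun w => F (cplField a n w)) ((noiseMeasure ω₂).map (cplRestrict a n)) :=
    (hF.comp (measurable_cplField a n)).aestronglyMeasurable
  rw [← noiseMeasure_map_cplRestrict ω₂ a n, integral_map (measurable_cplRestrict a n).aemeasurable hm]
  refine integral_congr_ae (ae_of_all _ fun ζ => ?_)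
  dsimp only
  rw [cplField_cplRestrict]

/-- Integrability of box observables against the coupling law is integrability against the noise.
[folklore] -/
theorem integrable_comp_cplField_iff {F : (Fin (n + 1) → ℝ × ℝ) → ℝ} (hF : Measurable F) :
    Integrable (fun w => F (cplField a n w)) (cplMeasure ω₂ n) ↔
      Integrable (fun ζ => F (boxRestrictAt a n (gaussField ζ))) (noiseMeasure ω₂) := by
  have hm : AEStronglyMeasurable (fun w => F (cplField a n w)) ((noiseMeasure ω₂).map (cplRestrict a n)) :=
    (hF.comp (measurable_cplField a n)).aestronglyMeasurable
  rw [← noiseMeasure_map_cplRestrict ω₂ a n, integrable_map_measure hm (measurable_cplRestrict a n).aemeasurable]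
  exact integrable_congr (ae_of_all _ fun ζ => by simp only [Function.comp_apply, cplField_cplRestrict])

/-- The box integral of `ψ` against the coupling law is `∫ ψ dν_Λ`. [folklore] -/
theorem integral_comp_cplField_eq_integral_boxMarginal {ψ : (Fin (n + 1) → ℝ × ℝ) → ℝ} (hψ : Measurable ψ) :
    ∫ w, ψ (cplField a n w) ∂cplMeasure ω₂ n = ∫ x, ψ x ∂boxMarginal a n (harmonicState ω₂) := by
  rw [← cplMeasure_map_cplField ω₂ a n, integral_map (measurable_cplField a n).aemeasurable hψ.aestronglyMeasurable]

/-! ### The mean of the dominating quadratic -/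

/-- Measurability of the diagonal quadratic. [folklore] -/
theorem measurable_boxQuad (c : ℝ) : Measurable (boxQuad (n := n) c) := (continuous_boxQuad c).measurable

/-- **The dominating quadratic has mean `(n+1)((v₁+2)/2 + c)`** under the coupling law
(`E p² = v₁ + 2`, `E q² = 1` under the radiating state), and is integrable. [folklore] -/
theorem integral_boxQuad_cplField (c : ℝ) :
    Integrable (fun w => boxQuad c (cplField a n w)) (cplMeasure ω₂ n) ∧
      ∫ w, boxQuad c (cplField a n w) ∂cplMeasure ω₂ n = (n + 1) * (((noiseVar ω₂ 1 : ℝ) + 2) / 2 + c) := by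
  have hmeas := measurable_boxQuad n c
  have hterm : ∀ i : Fin (n + 1), Integrable (fun ζ : Src =>
      (gaussField ζ (a + i)).2 ^ 2 / 2 + c * (gaussField ζ (a + i)).1 ^ 2) (noiseMeasure ω₂) := fun i =>
    ((memLp_gaussField_snd ω₂ (a + i) 2 (by simp)).integrable_sq.div_const 2).add
      ((memLp_gaussField_fst ω₂ (a + i) 2 (by simp)).integrable_sq.const_mul c)
  have hint : Integrable (fun ζ : Src => boxQuad c (boxRestrictAt a n (gaussField ζ))) (noiseMeasure ω₂) := by
    simp only [boxQuad, boxRestrictAt_apply]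
    exact integrable_finsetSum _ fun i _ => hterm i
  refine ⟨(integrable_comp_cplField_iff ω₂ a n hmeas).2 hint, ?_⟩
  rw [integral_comp_cplField ω₂ a n hmeas]
  simp only [boxQuad, boxRestrictAt_apply]
  rw [integral_finsetSum _ fun i _ => hterm i]
  have hval : ∀ i : Fin (n + 1), ∫ ζ : Src, ((gaussField ζ (a + i)).2 ^ 2 / 2 + c * (gaussField ζ (a + i)).1 ^ 2)
      ∂noiseMeasure ω₂ = ((noiseVar ω₂ 1 : ℝ) + 2) / 2 + c := by
    intro i
    rw [integral_add ((memLp_gaussField_snd ω₂ (a + i) 2 (by simp)).integrable_sq.div_const 2)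
      ((memLp_gaussField_fst ω₂ (a + i) 2 (by simp)).integrable_sq.const_mul c),
      integral_div, integral_const_mul, integral_p_sq, integral_q_sq, mul_one]
  simp only [hval, Finset.sum_const, Finset.card_univ, Fintype.card_fin, nsmul_eq_mul, Nat.cast_add, Nat.cast_one]

/-! ### Gaussian product densities: normalisation and a uniform bound -/

/-- The product of standard Gaussian densities integrates to one. [folklore] -/
theorem lintegral_prod_gaussianPDFReal_eq_one (m : ℕ) :
    ∫⁻ u : Fin m → ℝ, ENNReal.ofReal (∏ j, gaussianPDFReal 0 1 (u j)) = 1 := by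
  have h := pi_gaussianReal_eq_withDensity_prod (fun _ : Fin m => (1 : ℝ≥0)) (fun _ => one_ne_zero)
  have h1 : (Measure.pi fun _ : Fin m => gaussianReal 0 (1 : ℝ≥0)) univ = 1 := measure_univ
  rw [h, withDensity_apply _ MeasurableSet.univ, Measure.restrict_univ] at h1
  exact h1

/-- A centred Gaussian density is bounded by its value at zero, `φ_v ≤ (√(2πv))⁻¹`. [folklore] -/
theorem gaussianPDFReal_le_inv_sqrt (v : ℝ≥0) (x : ℝ) : gaussianPDFReal 0 v x ≤ (Real.sqrt (2 * Real.pi * v))⁻¹ := by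
  rw [gaussianPDFReal_def]
  have h1 : Real.exp (-(x - 0) ^ 2 / (2 * (v : ℝ))) ≤ 1 := by
    rw [Real.exp_le_one_iff]
    exact div_nonpos_of_nonpos_of_nonneg (neg_nonpos.2 (sq_nonneg _)) (by positivity)
  calc (Real.sqrt (2 * Real.pi * v))⁻¹ * Real.exp (-(x - 0) ^ 2 / (2 * (v : ℝ)))
      ≤ (Real.sqrt (2 * Real.pi * v))⁻¹ * 1 := mul_le_mul_of_nonneg_left h1 (by positivity)
    _ = _ := mul_one _

/-- **Uniform bound on product Gaussian densities**: `∏ᵢ φ_v(zᵢ) ≤ exp(-(n+1) log √(2πv))`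
(`v ≠ 0`). [folklore] -/
theorem prod_gaussianPDFReal_le_exp {v : ℝ≥0} (hv : v ≠ 0) (z : Fin (n + 1) → ℝ) :
    ∏ i, gaussianPDFReal 0 v (z i) ≤ Real.exp (-((n + 1 : ℕ) : ℝ) * Real.log (Real.sqrt (2 * Real.pi * v))) := by
  have hs : 0 < Real.sqrt (2 * Real.pi * v) :=
    Real.sqrt_pos.2 (by have : (0 : ℝ) < v := NNReal.coe_pos.2 (pos_iff_ne_zero.2 hv); positivity)
  calc ∏ i, gaussianPDFReal 0 v (z i) ≤ ∏ _i : Fin (n + 1), (Real.sqrt (2 * Real.pi * v))⁻¹ :=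
        Finset.prod_le_prod (fun i _ => gaussianPDFReal_nonneg _ _ _) fun i _ => gaussianPDFReal_le_inv_sqrt v (z i)
    _ = (Real.sqrt (2 * Real.pi * v))⁻¹ ^ (n + 1) := by rw [Finset.prod_const, Finset.card_univ, Fintype.card_fin]
    _ = Real.exp (-((n + 1 : ℕ) : ℝ) * Real.log (Real.sqrt (2 * Real.pi * v))) := by
        rw [← Real.exp_log (pow_pos (inv_pos.2 hs) (n + 1)), Real.log_pow, Real.log_inv]
        congr 1
        ring

/-! ### The entropy step -/

/-- The un-normalised box integral `N_Λ(η) = ∫⁻ e^{ψ} e^{-H_Λ(·|η)}` is finite for bounded `ψ`.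
[folklore] -/
theorem boxN_lt_top (hω : 0 < ω₂) (γ : ℝ) (η : ChainConfig) {ψ : (Fin (n + 1) → ℝ × ℝ) → ℝ}
    {Cψ : ℝ} (hψb : ∀ x, |ψ x| ≤ Cψ) :
    (∫⁻ x : Fin (n + 1) → ℝ × ℝ, ENNReal.ofReal (Real.exp (ψ x) * Real.exp (-(1 : ℝ)⁻¹ *
        hamiltonianIn (pinnedChain ω₂ 0 0 γ).chainPotential OscillatorChain.chainSupp (Finset.Icc a (a + n))
          (insBox a n η x)))) < ∞ := by
  have hZ := boxZ_lt_top ω₂ a n hω γ η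
  rw [lmarginal_Icc_eq_lintegral_insBox] at hZ
  have hWm : Measurable fun x : Fin (n + 1) → ℝ × ℝ => ENNReal.ofReal (Real.exp (-(1 : ℝ)⁻¹ *
      hamiltonianIn (pinnedChain ω₂ 0 0 γ).chainPotential OscillatorChain.chainSupp (Finset.Icc a (a + n))
        (insBox a n η x))) :=
    ((pinnedChain ω₂ 0 0 γ).measurable_boltzmannWeight (measurable_U_harmonic ω₂ γ) (measurable_V_harmonic ω₂ γ) 1 _).comp
      (measurable_insBox a n η)
  calc _ ≤ ∫⁻ x : Fin (n + 1) → ℝ × ℝ, ENNReal.ofReal (Real.exp Cψ) * ENNReal.ofReal (Real.exp (-(1 : ℝ)⁻¹ *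
          hamiltonianIn (pinnedChain ω₂ 0 0 γ).chainPotential OscillatorChain.chainSupp (Finset.Icc a (a + n))
            (insBox a n η x))) := by
        refine lintegral_mono fun x => ?_
        rw [← ENNReal.ofReal_mul (Real.exp_pos _).le]
        exact ENNReal.ofReal_le_ofReal (mul_le_mul_of_nonneg_right
          (Real.exp_le_exp.2 ((le_abs_self _).trans (hψb x))) (Real.exp_pos _).le)
    _ = ENNReal.ofReal (Real.exp Cψ) * ∫⁻ x : Fin (n + 1) → ℝ × ℝ, ENNReal.ofReal (Real.exp (-(1 : ℝ)⁻¹ *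
          hamiltonianIn (pinnedChain ω₂ 0 0 γ).chainPotential OscillatorChain.chainSupp (Finset.Icc a (a + n))
            (insBox a n η x))) := lintegral_const_mul _ hWm
    _ < ∞ := ENNReal.mul_lt_top ENNReal.ofReal_lt_top hZ

/-- **The entropy step.** For `ω₂ > 0`, every boundary condition `η` and every measurable bounded
`ψ` on box data,
`N_Λ(η) ≥ exp(∫ ψ dν_Λ - (n+1) A - q_{a-1}(η)² - q_{a+n+1}(η)²)` with
`A = (v₁+2)/2 + (ω₂/2 + 2) - log √(2π) - log √(2πv₁)`, `v₁ = noiseVar ω₂ 1` — Jensen for `exp` under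
the Gaussian coupling of the box marginal `ν_Λ` of the radiating state. [folklore] -/
theorem boxN_ge (hω : 0 < ω₂) (γ : ℝ) (η : ChainConfig) {ψ : (Fin (n + 1) → ℝ × ℝ) → ℝ} (hψ : Measurable ψ)
    {Cψ : ℝ} (hψb : ∀ x, |ψ x| ≤ Cψ) :
    ENNReal.ofReal (Real.exp ((∫ x, ψ x ∂boxMarginal a n (harmonicState ω₂)) -
        (n + 1) * (((noiseVar ω₂ 1 : ℝ) + 2) / 2 + (ω₂ / 2 + 2) -
          (Real.log (Real.sqrt (2 * Real.pi)) + Real.log (Real.sqrt (2 * Real.pi * noiseVar ω₂ 1)))) -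
        ((η (a - 1)).1 ^ 2 + (η (a + n + 1)).1 ^ 2))) ≤
      ∫⁻ x : Fin (n + 1) → ℝ × ℝ, ENNReal.ofReal (Real.exp (ψ x) * Real.exp (-(1 : ℝ)⁻¹ *
        hamiltonianIn (pinnedChain ω₂ 0 0 γ).chainPotential OscillatorChain.chainSupp (Finset.Icc a (a + n))
          (insBox a n η x))) := by
  -- facts to be folded by the notation below
  obtain ⟨hQi, hQval⟩ := integral_boxQuad_cplField ω₂ a n (ω₂ / 2 + 2)
  have hIψ' := integral_comp_cplField_eq_integral_boxMarginal ω₂ a n hψ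
  have hdens0 := cplMeasure_eq_withDensity ω₂ n hω
  -- notation
  set P := pinnedChain ω₂ 0 0 γ with hP
  set Λ := Finset.Icc a (a + n) with hΛ
  set G := cplMeasure ω₂ n with hG
  set S := cplField a n with hS
  set v₁ : ℝ≥0 := noiseVar ω₂ 1 with hv₁
  have hv₁0 : v₁ ≠ 0 := by simp [hv₁, noiseVar, hω]
  set c : ℝ := ω₂ / 2 + 2 with hc
  set κ : ℝ := Real.log (Real.sqrt (2 * Real.pi)) + Real.log (Real.sqrt (2 * Real.pi * v₁)) with hκ
  set bd : ℝ := (η (a - 1)).1 ^ 2 + (η (a + n + 1)).1 ^ 2 with hbd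
  set Iψ : ℝ := ∫ x, ψ x ∂boxMarginal a n (harmonicState ω₂) with hIψ
  set W : (Fin (n + 1) → ℝ × ℝ) → ℝ := fun x =>
    Real.exp (-(1 : ℝ)⁻¹ * hamiltonianIn P.chainPotential OscillatorChain.chainSupp Λ (insBox a n η x)) with hW
  set gQ : (Fin (n + 1) → ℝ) → ℝ := fun q => ∏ i, gaussianPDFReal 0 1 (q i) with hgQ
  set gE : (Fin (n + 5) → ℝ) → ℝ := fun u => ∏ j, gaussianPDFReal 0 1 (u j) with hgE
  set gP : (Fin (n + 1) → ℝ) → ℝ := fun e => ∏ i, gaussianPDFReal 0 v₁ (e i) with hgP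
  -- the exponent `f` (a lower bound of `ψ∘S + log W∘S + log(gE/gd)`)
  set f : Cpl n → ℝ := fun w => ψ (S w) - boxQuad c (S w) - bd + ((n + 1 : ℕ) : ℝ) * κ with hf
  -- measurability
  have hWm : Measurable W := by
    refine Real.measurable_exp.comp (Measurable.const_mul ?_ _)
    exact (P.measurable_hamiltonianIn_chain (measurable_U_harmonic ω₂ γ) (measurable_V_harmonic ω₂ γ) Λ).comp
      (measurable_insBox a n η)
  have hSm : Measurable S := measurable_cplField a n
  have hfm : Measurable f :=
    (((hψ.comp hSm).sub ((measurable_boxQuad n c).comp hSm)).sub measurable_const).add measurable_const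
  have hFm : Measurable fun x : Fin (n + 1) → ℝ × ℝ => ENNReal.ofReal (Real.exp (ψ x) * W x) :=
    ENNReal.measurable_ofReal.comp ((Real.measurable_exp.comp hψ).mul hWm)
  have hgEm : Measurable fun u : Fin (n + 5) → ℝ => ENNReal.ofReal (gE u) := measurable_ofReal_prod_gaussianPDFReal _
  -- Step 1: the pointwise inequality `e^{f} gd ≤ e^{ψ∘S} W∘S gE`
  have hWge : ∀ w : Cpl n, Real.exp (-boxQuad c (S w) - bd) ≤ W (S w) := by
    intro w
    simp only [hW, inv_one, neg_mul, one_mul]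
    exact Real.exp_le_exp.2 (by linarith [hamiltonianIn_insBox_le ω₂ a n γ η (S w)])
  have hgQP : ∀ w : Cpl n, gQ w.1.1 * gP w.2 ≤ Real.exp (-(((n + 1 : ℕ) : ℝ) * κ)) := by
    intro w
    have h1 := prod_gaussianPDFReal_le_exp n (one_ne_zero) w.1.1
    have h2 := prod_gaussianPDFReal_le_exp n hv₁0 w.2
    calc gQ w.1.1 * gP w.2 ≤ Real.exp (-((n + 1 : ℕ) : ℝ) * Real.log (Real.sqrt (2 * Real.pi * (1 : ℝ≥0)))) *
          Real.exp (-((n + 1 : ℕ) : ℝ) * Real.log (Real.sqrt (2 * Real.pi * v₁))) :=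
          mul_le_mul h1 h2 (prod_gaussianPDFReal_nonneg _ _) (Real.exp_pos _).le
      _ = Real.exp (-(((n + 1 : ℕ) : ℝ) * κ)) := by
          rw [← Real.exp_add, hκ]; congr 1; push_cast; ring
  have hpt : ∀ w : Cpl n, Real.exp (f w) * (gQ w.1.1 * gE w.1.2 * gP w.2) ≤
      Real.exp (ψ (S w)) * W (S w) * gE w.1.2 := by
    intro w
    have hgE0 : 0 ≤ gE w.1.2 := prod_gaussianPDFReal_nonneg _ _
    have hrew : Real.exp (f w) * (gQ w.1.1 * gE w.1.2 * gP w.2) =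
        gE w.1.2 * (Real.exp (ψ (S w)) * (Real.exp (-boxQuad c (S w) - bd) *
          (Real.exp (((n + 1 : ℕ) : ℝ) * κ) * (gQ w.1.1 * gP w.2)))) := by
      simp only [hf]
      rw [show ψ (S w) - boxQuad c (S w) - bd + ((n + 1 : ℕ) : ℝ) * κ =
        ψ (S w) + (-boxQuad c (S w) - bd) + ((n + 1 : ℕ) : ℝ) * κ by ring, Real.exp_add, Real.exp_add]
      ring
    rw [hrew]
    have h3 : Real.exp (((n + 1 : ℕ) : ℝ) * κ) * (gQ w.1.1 * gP w.2) ≤ 1 := by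
      calc Real.exp (((n + 1 : ℕ) : ℝ) * κ) * (gQ w.1.1 * gP w.2)
          ≤ Real.exp (((n + 1 : ℕ) : ℝ) * κ) * Real.exp (-(((n + 1 : ℕ) : ℝ) * κ)) :=
            mul_le_mul_of_nonneg_left (hgQP w) (Real.exp_pos _).le
        _ = 1 := by rw [← Real.exp_add, add_neg_cancel, Real.exp_zero]
    calc gE w.1.2 * (Real.exp (ψ (S w)) * (Real.exp (-boxQuad c (S w) - bd) *
          (Real.exp (((n + 1 : ℕ) : ℝ) * κ) * (gQ w.1.1 * gP w.2))))
        ≤ gE w.1.2 * (Real.exp (ψ (S w)) * (W (S w) * 1)) := by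
          refine mul_le_mul_of_nonneg_left (mul_le_mul_of_nonneg_left ?_ (Real.exp_pos _).le) hgE0
          exact mul_le_mul (hWge w) h3 (mul_nonneg (Real.exp_pos _).le
            (mul_nonneg (prod_gaussianPDFReal_nonneg _ _) (prod_gaussianPDFReal_nonneg _ _))) (Real.exp_pos _).le
      _ = Real.exp (ψ (S w)) * W (S w) * gE w.1.2 := by ring
  -- Step 2: `∫⁻ e^f dG ≤ N_Λ(η)`
  have hkey : ∫⁻ w, ENNReal.ofReal (Real.exp (f w)) ∂G ≤
      ∫⁻ x : Fin (n + 1) → ℝ × ℝ, ENNReal.ofReal (Real.exp (ψ x) * W x) := by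
    have hN : ∫⁻ x : Fin (n + 1) → ℝ × ℝ, ENNReal.ofReal (Real.exp (ψ x) * W x) =
        ∫⁻ w : Cpl n, ENNReal.ofReal (Real.exp (ψ (S w)) * W (S w)) * ENNReal.ofReal (gE w.1.2) := by
      rw [lintegral_cplField_mul a n _ hFm _ hgEm, lintegral_prod_gaussianPDFReal_eq_one, mul_one]
    have hdens : Measurable fun w : Cpl n =>
        ENNReal.ofReal (gQ w.1.1) * ENNReal.ofReal (gE w.1.2) * ENNReal.ofReal (gP w.2) :=
      (((measurable_ofReal_prod_gaussianPDFReal _).comp (measurable_fst.comp measurable_fst)).mul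
        ((measurable_ofReal_prod_gaussianPDFReal _).comp (measurable_snd.comp measurable_fst))).mul
        ((measurable_ofReal_prod_gaussianPDFReal _).comp measurable_snd)
    have hem : Measurable fun w : Cpl n => ENNReal.ofReal (Real.exp (f w)) :=
      ENNReal.measurable_ofReal.comp (Real.measurable_exp.comp hfm)
    rw [hN, hdens0, lintegral_withDensity_eq_lintegral_mul _ hdens hem]
    refine lintegral_mono fun w => ?_
    simp only [Pi.mul_apply]
    rw [← ENNReal.ofReal_mul (prod_gaussianPDFReal_nonneg _ _), ← ENNReal.ofReal_mul
        (mul_nonneg (prod_gaussianPDFReal_nonneg _ _) (prod_gaussianPDFReal_nonneg _ _)),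
      ← ENNReal.ofReal_mul (mul_nonneg (mul_nonneg (prod_gaussianPDFReal_nonneg _ _) (prod_gaussianPDFReal_nonneg _ _))
        (prod_gaussianPDFReal_nonneg _ _)),
      ← ENNReal.ofReal_mul (mul_nonneg (Real.exp_pos _).le (Real.exp_pos _).le)]
    refine ENNReal.ofReal_le_ofReal ?_
    rw [mul_comm]
    exact hpt w
  -- Step 3: integrability of `f` and `e^f` under `G`
  haveI : IsProbabilityMeasure G := by rw [hG]; infer_instance
  have hψSi : Integrable (fun w => ψ (S w)) G :=
    (integrable_const Cψ).mono' (hψ.comp hSm).aestronglyMeasurable (ae_of_all _ fun w => (Real.norm_eq_abs _).le.trans (hψb _))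
  have h1i : Integrable (fun w => ψ (S w) - boxQuad c (S w)) G := hψSi.sub hQi
  have h2i : Integrable (fun w => ψ (S w) - boxQuad c (S w) - bd) G := h1i.sub (integrable_const _)
  have hfi : Integrable f G := h2i.add (integrable_const _)
  have hNlt := boxN_lt_top ω₂ a n hω γ η hψb
  have hexpi : Integrable (fun w => Real.exp (f w)) G := by
    refine ⟨(Real.measurable_exp.comp hfm).aestronglyMeasurable, ?_⟩
    rw [hasFiniteIntegral_iff_ofReal (ae_of_all _ fun w => (Real.exp_pos _).le)]
    exact lt_of_le_of_lt hkey hNlt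
  -- Step 4: Jensen
  have hJ : Real.exp (∫ w, f w ∂G) ≤ ∫ w, Real.exp (f w) ∂G :=
    (convexOn_exp).map_integral_le Real.continuous_exp.continuousOn isClosed_univ
      (ae_of_all _ fun _ => mem_univ _) hfi hexpi
  -- Step 5: the value of `∫ f dG`
  have hIf : ∫ w, f w ∂G = Iψ - (n + 1) * (((v₁ : ℝ) + 2) / 2 + c) - bd + ((n + 1 : ℕ) : ℝ) * κ := by
    simp only [hf]
    rw [integral_add h2i (integrable_const _), integral_sub h1i (integrable_const _), integral_sub hψSi hQi,
      integral_const, integral_const, hQval, hIψ']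
    simp
  -- conclusion
  calc ENNReal.ofReal (Real.exp (Iψ - (n + 1) * (((v₁ : ℝ) + 2) / 2 + (ω₂ / 2 + 2) - κ) - bd))
      = ENNReal.ofReal (Real.exp (∫ w, f w ∂G)) := by
        rw [hIf]; congr 2; push_cast; ring
    _ ≤ ENNReal.ofReal (∫ w, Real.exp (f w) ∂G) := ENNReal.ofReal_le_ofReal hJ
    _ = ∫⁻ w, ENNReal.ofReal (Real.exp (f w)) ∂G :=
        ofReal_integral_eq_lintegral_ofReal hexpi (ae_of_all _ fun w => (Real.exp_pos _).le)
    _ ≤ _ := hkey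

end Summit.AtomisticToContinuum.FouriersLaw.Theorems.ParityLiouvilleSeed.HarmonicWitness

end
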